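import Literature.Barriers.BirchSwinnertonDyer.RankNotSumOfLocalInvariantsF3NormDescentK103Proofs
import Literature.NumberTheory.NumberFields.CyclicCubicField1339BDescent
import HarnessLib

/-!
# Barrier (BirchSwinnertonDyer), rank mod `3`: the conductor-`1339` descent with `2` inert, and what remains

Continuation of `RankNotSumOfLocalInvariantsF3NormDescentK103Proofs.lean` towards the named fact
`Literature.Barriers.BirchSwinnertonDyer.DokchitserDokchitser2011_rank_480a1_F3` (`rk E(F₃) = 1` for
`E = 480a1` over the degree-`9` field `F₃ ⊂ ℚ(ζ₁₃, ζ₁₀₃)` of T. Dokchitser–V. Dokchitser, *A note on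
the Mordell–Weil rank modulo `n`*, J. Number Theory 131 (2011), proof of Thm. 2). Here the THIRD of
the four cubic norm descents is discharged, over every cubic extension of `ℚ` containing a root of
`f'' = X³ + X² - 446X - 3769` (the cyclic cubic field of conductor `1339` in which `2` is inert), by
the explicit `2`-descent of `Literature/NumberTheory/NumberFields/CyclicCubicField1339BDescent.lean`
(`Literature.NumberTheory.NumberFields.CyclicCubic1339B.normDescent_of_root`; the class group of
this field is not trivial, but it has exponent `3`, which is all the descent needs):

* `curve480a1.normDescent_of_root1339b`, `curve480a1.mordellWeilRank_baseChange_eq_one_of_root1339b`;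
* `DokchitserDokchitser2011_rank_480a1_F3_of_normDescent_1339a`: CONSEQUENTLY the named fact
  follows from the single remaining norm-`1` descent statement, for the cyclic cubic field of
  conductor `1339` generated by a root of `f' = X³ + X² - 446X + 248` (the one in which `2` splits),
  which remains as a hypothesis (no named fact is introduced).

## References

* T. Dokchitser, V. Dokchitser, *A note on the Mordell–Weil rank modulo `n`*, J. Number Theory 131
  (2011) 1833–1839, arXiv:0910.4588: proof of Thm. 2. [DokchitserDokchitser2011RankModN]
* J. H. Silverman, *The Arithmetic of Elliptic Curves*, 2nd ed., GTM 106 (2009): Prop. X.1.4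
  (complete `2`-descent). [SilvermanAEC2009]
-/

noncomputable section

open scoped NumberField

open NumberField WeierstrassCurve IntermediateField

namespace Literature.Barriers.BirchSwinnertonDyer

open Literature.NumberTheory.NumberFields

namespace curve480a1

/-- **The norm-`1` `2`-descent of `480a1` over the cubic field of conductor `1339` with `2` inert, in
every presentation**: for a cubic extension `K/ℚ` containing a root `θ` of
`f'' = X³ + X² - 446X - 3769` and a point `(x, y) ∈ E(K)`, `x ≠ 0, -2, 3`, with `N_{K/ℚ}(x)`,
`N_{K/ℚ}(x + 2)` rational squares, `x` and `x + 2` are squares in `K`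
(`CyclicCubic1339B.normDescent_of_root`). [cite: DokchitserDokchitser2011RankModN, proof of Thm. 2] -/
theorem normDescent_of_root1339b (K : Type) [Field K] [Algebra ℚ K] (h3 : Module.finrank ℚ K = 3)
    {θ : K} (hθ : θ ^ 3 + θ ^ 2 - 446 * θ - 3769 = 0) :
    ∀ x y : K, (curve480a1.baseChange K).toAffine.Nonsingular x y →
      x ≠ 0 → x ≠ -2 → x ≠ 3 → IsSquare (Algebra.norm ℚ x) → IsSquare (Algebra.norm ℚ (x + 2)) →
      IsSquare x ∧ IsSquare (x + 2) := fun _ _ hxy h0 h2 h3' hN hN2 =>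
  have hpt := eq_and_ne_of_nonsingular K hxy h0 h2 h3'
  CyclicCubic1339B.normDescent_of_root h3 hθ hpt.1 hpt.2 hN hN2

/-- **`rk E(K) = 1` for `E = 480a1` over every Galois cubic number field containing a root of
`f''`** (the third case of "2-descent […] over all minimal non-trivial subfields of `F₃`").
[cite: DokchitserDokchitser2011RankModN, proof of Thm. 2] -/
theorem mordellWeilRank_baseChange_eq_one_of_root1339b (K : Type) [Field K] [NumberField K]
    [Algebra ℚ K] [IsGalois ℚ K] (h3 : Module.finrank ℚ K = 3) {θ : K}
    (hθ : θ ^ 3 + θ ^ 2 - 446 * θ - 3769 = 0) : (curve480a1.baseChange K).mordellWeilRank = 1 :=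
  mordellWeilRank_baseChange_eq_one_of_odd_of_normDescent K (by rw [h3]; exact ⟨1, rfl⟩)
    (normDescent_of_root1339b K h3 hθ)

end curve480a1

/-- **What remains of the `n = 3` fact after the conductor-`13`, conductor-`103` and
conductor-`1339` (`2` inert) descents.** The named fact `DokchitserDokchitser2011_rank_480a1_F3`
follows from the norm-`1` `2`-descent statement of `480a1` over the cubic extensions of `ℚ`
generated by a root of `f' = X³ + X² - 446X + 248` (the cyclic cubic field of conductor `1339` in
which `2` splits completely). [cite: DokchitserDokchitser2011RankModN, proof of Thm. 2] -/
theorem DokchitserDokchitser2011_rank_480a1_F3_of_normDescent_1339a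
    (h1339a : ∀ (K : Type) [Field K] [Algebra ℚ K], Module.finrank ℚ K = 3 →
      ∀ θ : K, θ ^ 3 + θ ^ 2 - 446 * θ + 248 = 0 → ∀ x y : K, y ^ 2 = x * (x + 2) * (x - 3) →
        y ≠ 0 → IsSquare (Algebra.norm ℚ x) → IsSquare (Algebra.norm ℚ (x + 2)) →
        IsSquare x ∧ IsSquare (x + 2)) :
    DokchitserDokchitser2011_rank_480a1_F3 :=
  DokchitserDokchitser2011_rank_480a1_F3_of_normDescent_1339 h1339a
    (fun _ _ _ h3 _ hθ _ _ hE hy hN hN2 => CyclicCubic1339B.normDescent_of_root h3 hθ hE hy hN hN2)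

end Literature.Barriers.BirchSwinnertonDyer

end
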